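/-
Copyright (c) 2026 the pub-hodgecm-mathlib formalisation cell (harness21).  Prover seat hodgecm-mathlib-LH4-p01 (g9), 2026-09-02.  LH4 road «M6 ROW 2 ★ DYADIC TWIN»
(LEAD F0P3a-plan T14-66 «ROAD-LIMITED GO»; LH4-plan (g8) WORD #38 DEAL g8-#7, brick F4-a′, names by WORD #44): the (D2-β) eigen-field package on the UNIFORMISER frame
at ANY residue characteristic (the `|2|_v = 1` binder of ★ (D2-β) removed).
-/
import Literature.NumberTheory.Rogawski1990.TypeTwoEigenFieldPackage    -- ★ (D2-β) p846… (F0P2-p06 (g11)): the `|2| = 1` original (statement reproduced token for token below, minus `h2`); brings ★ [T2-L] (L1)(L2)(L3)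
import Literature.NumberTheory.Rogawski1990.TypeTwoEigenvalueWild       -- ★ p851716 (B-p04 (g47)): `v_le_one_of_root_quadratic`, `v_lt_one_of_root_quadratic` (root arguments, no `|2|`)
import HarnessLib

/-!
# (D2-β)″ «THE EIGEN-FIELD PACKAGE AT w», UNIFORMISER FRAME, ANY RESIDUE CHARACTERISTIC: `θ = √d` (`d` a uniformiser of `F_v`: the tame row and the odd-order wild row),
# `s̃ ∕ ι′`, `λ₁ = (t + yθ)∕2`, (rE)(nK)(nE) — ★ (D2-β) without `|2|_v = 1`

Topic `NumberTheory/Rogawski1990`; namespace `Literature.NumberTheory.Rogawski1990`.  ONE THEOREM (no definition, no instance, no notation, no named fact, no `sorry`); kernel lane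
`--supports stmt-HodgeConjecture-24833`.  Cell `pub/hodgecm-mathlib` (D-0151), crux H413 = `stmt-HodgeConjecture-24833`; LH4 road «M6 ROW 2 ★ DYADIC TWIN» (LEAD T14-66, dealer
LH4-plan (g8) WORD #38 g8-#7 F4-a′, WORD #44 (Q-a)(Q-c); sigsheet `F0/P3c/LH4/LH4-p01/g9/o4/f4a/SIG-F4a-TypeTwoDyadicDescent.v1.LH4p01g9.md`).  UNIFORMISER FRAME, ANY RESIDUE
CHARACTERISTIC; SUPERSEDES NOTHING — ★ (D2-β) keeps its consumers ((D3)∕(D4)∕(D5), B-p14's (D2-γ)); the W-ODD dyadic place head `TypeTwoUnitIndexAtPlaceWildOdd` (LH10-p01, g8-#11) consumes THIS file.  **Statement = ★ (D2-β)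
`TypeTwoEigenFieldPackage.exists_eigenField_package` TOKEN FOR TOKEN, with the binder `h2 : Valued.v (2 : F_v) = 1` DELETED, the binder `hχ1 : |1 − t + D|_v < 1` ADDED** (the
residual-unipotence datum of ★ (D2-β)′ `TypeTwoEigenFieldPackageWild`; at a deep match it is ★ `v_charpoly_one_lt_one`) **and ONE NEW CONJUNCT (L1′): the Eisenstein
coordinates `(e₂t, e₂y)` of `λ₁ = ι(e₂t) + ι(e₂y)·θ` are INTEGRAL in `F_v`** (from «`λ₁ ∈ 𝒪`» by a root argument + ★ (L1) `hint`; invisible at `|2| = 1`, it is the level datum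
`N′ = ord(e₂y) = N − ord_v 2` of the W-odd place head).  So the ODD-ORDER WILD row `K₂ = L_w(√(ϖ·unit))`
(`d(K₂∕L_w) = 2e + 1`) of a dyadic inert-unramified place gets the same package as the tame row, and every (D3)∕(D4)∕(D5)-type consumer switches rows by substitution.
HONEST LABEL: HC_CM is proved only modulo the 7 printed citations (2 remaining named inputs: hLiu418 = stmt-HodgeConjecture-24832, h413 = stmt-HodgeConjecture-24833) until rung 0
closes; unconditional local algebra, count-neutral (pays no organ, opens no road; zero label movement until F5 ★ and a desk-priced rider).

WHAT CHANGES IN THE PROOF (everything else is ★ (D2-β)'s proof verbatim): `2 ≠ 0` from `e₂·2 = 1` (characteristic 0, not `|2| = 1`); «`λ₁ ∈ 𝒪`» by the ROOT ARGUMENT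
★ `v_le_one_of_root_quadratic` (`λ₁² − ι₁t·λ₁ + ι₁D = 0`, `|t| ≤ max(|t−2|,|2|) ≤ 1`, `|D| = 1` from `D·sD = 1`) instead of `|e₂| = 1`; «`|λ₁ − 1| < 1`» by ★ `v_lt_one_of_root_quadratic`
on the shifted polynomial `(X+1)² − t(X+1) + D = X² − (t−2)X + (1 − t + D)` with `|t − 2| < 1`, `|1 − t + D| < 1` — the two `|e₂| = 1` steps of ★ (D2-β) named in ★
`TypeTwoEigenvalueWild`'s docstring (its §1 lemmas are cited directly; the packaged `eigenvalue_clauses_of_skew_sqrt` proves the same clauses in the two-field frame).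
No `IsUnit 2`, no `|2| = 1`, no `d(K₂∕L_w)` binder (T14-66 KILL clause honoured); `h2e : e₂·2 = 1` is a characteristic-0 DEFINITION of `e₂ ∈ F_v`, as in ★ (D2-β)′.

## References
* [Rogawski1990] J. D. Rogawski, *Automorphic Representations of Unitary Groups in Three Variables* (1990): §4.9 Lemma 4.9.3 p. 56, Prop. 4.9.1 (b) p. 55.
* [SerreLocalFields1979] J.-P. Serre, *Local Fields*, GTM 67 (1979): Ch. I §6 Prop. 17–18; Ch. V §2 Prop. 3 and Corollary.
* [Jacobowitz1962] R. Jacobowitz, *Hermitian forms over local fields*, Amer. J. Math. 84 (1962): §5, §7, §§9–11.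
-/

set_option autoImplicit false

noncomputable section

open NumberField IsDedekindDomain Polynomial
open scoped ValuativeRel
open Literature.NumberTheory.Automorphic Literature.NumberTheory.Automorphic.UnitaryGroup Literature.NumberTheory.NumberFields

namespace Literature.NumberTheory.Rogawski1990

variable {F : Type} (E : Type) [Field F] [NumberField F] [Field E] [NumberField E] [Algebra F E] [Algebra.IsQuadraticExtension F E]
  (v : HeightOneSpectrum (𝓞 F)) (σ : E ≃ₐ[F] E) {δ : E} (hσδ : σ δ = -δ) (hδ : δ ≠ 0) {m : F} (hm : algebraMap F E m = δ ^ 2)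
  {d : v.adicCompletion F} (hd : Valued.v d = WithZero.exp (-1 : ℤ)) (hdm : IsSquare (d⁻¹ * (m : v.adicCompletion F)))
  (w : PlacesOver E v)
  -- the isometric involution `s` of `F_v` fixing `d` (CM conjugation `σ_w` of `L_w` in the application), moving an integer by a unit, with the even-order norm dictionary
  (s : v.adicCompletion F →+* v.adicCompletion F) (hss : ∀ x, s (s x) = x) (hsd : s d = d) (hsv : ∀ x, Valued.v (s x) = Valued.v x)
  (hmove : ∃ a : 𝒪[v.adicCompletion F], IsUnit a ∧ s a - a ∈ 𝒪[v.adicCompletion F] ∧ ∃ b : 𝒪[v.adicCompletion F], (b : v.adicCompletion F) * (s a - a) = 1)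
  (hnormF : ∀ c : v.adicCompletion F, c ≠ 0 → s c = c → Even (WithZero.log (Valued.v c)) → ∃ a : v.adicCompletion F, a * s a * c = 1)
  -- the type-(2) eigen-data of a deep match (★ (D1)): `χ_g = X² − tX + D`, `disc χ_g = y² d`, the norm-one eigenvalue `u`, `e₂ = 1∕2`
  (u t D y e₂ : v.adicCompletion F) (h2e : e₂ * 2 = 1) (hD : 4 * D = t * t - y * y * d)
  (hσD : D * s D = 1) (hσt : s t = t * s D) (hσy : s y = -(y * s D))
  {n N : ℕ} (hn : Valued.v (u * u - t * u + D) = WithZero.exp (-(n : ℤ))) (hN : Valued.v y = WithZero.exp (-(N : ℤ)))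
  (ht2 : Valued.v (t - 2) < 1) (hχ1 : Valued.v (1 - t + D) < 1)

include hσδ hδ hm hd hdm hss hsd hsv hmove hnormF h2e hD hσD hσt hσy hn hN ht2 hχ1 in
/-- **(D2-β)″ THE EIGEN-FIELD PACKAGE AT `w`, UNIFORMISER FRAME, ANY RESIDUE CHARACTERISTIC** — the conclusion of ★ `exists_eigenField_package` verbatim; binders: `h2`
deleted, `hχ1` added; one conjunct (L1′) «`e₂t, e₂y ∈ 𝒪_v`» appended (see the module docstring).  Row: `d` a UNIFORMISER of `F_v` (the tame row at `v ∤ 2`; the odd-order wild row `d(K₂∕L_w) = 2e+1` at `v ∣ 2`).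
[cite: Rogawski1990, §4.9 Lemma 4.9.3 p. 56] [cite: SerreLocalFields1979, Ch. I §6 Prop. 17–18; Ch. V §2 Prop. 3] [cite: Jacobowitz1962, §5] -/
theorem exists_eigenField_package_uniformiser :
    ∃ (θ : w.1.adicCompletion E) (s' ι' : w.1.adicCompletion E →+* w.1.adicCompletion E),
      -- (L1) `θ = √d` and the Eisenstein coordinates
      (θ ^ 2 = toPlace v w d ∧ Valued.v θ = WithZero.exp (-1 : ℤ) ∧
        (∀ z : w.1.adicCompletion E, ∃! pq : v.adicCompletion F × v.adicCompletion F, z = toPlace v w pq.1 + toPlace v w pq.2 * θ) ∧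
        (∀ p q : v.adicCompletion F, toPlace v w p + toPlace v w q * θ ∈ 𝒪[w.1.adicCompletion E] ↔ p ∈ 𝒪[v.adicCompletion F] ∧ q ∈ 𝒪[v.adicCompletion F])) ∧
      -- (L2) the involution `s̃` over `s` fixing `θ`, isometric
      ((∀ x, s' (toPlace v w x) = toPlace v w (s x)) ∧ s' θ = θ ∧ (∀ z, s' (s' z) = z) ∧
        (∀ z : 𝒪[w.1.adicCompletion E], s' z ∈ 𝒪[w.1.adicCompletion E]) ∧ (∀ z, Valued.v (s' z) = Valued.v z)) ∧
      -- (L2) the `F_v`-linear involution `ι′` with `ι′ θ = −θ`, isometric, commuting with `s̃`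
      ((∀ x, ι' (toPlace v w x) = toPlace v w x) ∧ ι' θ = -θ ∧ (∀ z, ι' (ι' z) = z) ∧
        (∀ z : 𝒪[w.1.adicCompletion E], ι' z ∈ 𝒪[w.1.adicCompletion E]) ∧ (∀ z, Valued.v (ι' z) = Valued.v z) ∧ (∀ z, s' (ι' z) = ι' (s' z))) ∧
      -- the eigenvalue `λ₁ := (ι₁ t + ι₁ y · θ) · ι₁ e₂`
      (((toPlace v w t + toPlace v w y * θ) * toPlace v w e₂) ^ 2 - toPlace v w t * ((toPlace v w t + toPlace v w y * θ) * toPlace v w e₂) + toPlace v w D = 0 ∧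
        (toPlace v w t + toPlace v w y * θ) * toPlace v w e₂ ∈ 𝒪[w.1.adicCompletion E] ∧
        Valued.v ((toPlace v w t + toPlace v w y * θ) * toPlace v w e₂ - 1) < 1 ∧
        (toPlace v w t + toPlace v w y * θ) * toPlace v w e₂ * s' ((toPlace v w t + toPlace v w y * θ) * toPlace v w e₂) = 1 ∧
        ι' ((toPlace v w t + toPlace v w y * θ) * toPlace v w e₂) = (toPlace v w t - toPlace v w y * θ) * toPlace v w e₂ ∧
        ι' ((toPlace v w t + toPlace v w y * θ) * toPlace v w e₂) ≠ (toPlace v w t + toPlace v w y * θ) * toPlace v w e₂ ∧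
        Valued.v (toPlace v w u - (toPlace v w t + toPlace v w y * θ) * toPlace v w e₂) = WithZero.exp (-(n : ℤ)) ∧
        Valued.v ((toPlace v w t + toPlace v w y * θ) * toPlace v w e₂ - ι' ((toPlace v w t + toPlace v w y * θ) * toPlace v w e₂)) =
          WithZero.exp (-((2 * N + 1 : ℕ) : ℤ))) ∧
      -- the three norm dictionaries (rE) (nK) (nE) of ★ `exists_rational_good_iff_even`, in its binder spelling
      ((∀ x : w.1.adicCompletion E, x ≠ 0 → ι' x = x → Even (WithZero.log (Valued.v x))) ∧
        (∀ c : w.1.adicCompletion E, c ≠ 0 → s' c = c → Even (WithZero.log (Valued.v c)) → ∃ a : w.1.adicCompletion E, a * s' a * c = 1) ∧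
        (∀ c : w.1.adicCompletion E, c ≠ 0 → s' c = c → ι' c = c → (4 : ℤ) ∣ WithZero.log (Valued.v c) →
          ∃ a : w.1.adicCompletion E, ι' a = a ∧ a * s' a * c = 1)) ∧
      -- (L1′) NEW AT `p = 2`: the Eisenstein coordinates `(e₂t, e₂y)` of `λ₁` on `(1, θ)` are INTEGRAL (trivial when `|2| = 1`; the W-odd place head's `pO, qO`)
      (e₂ * t ∈ 𝒪[v.adicCompletion F] ∧ e₂ * y ∈ 𝒪[v.adicCompletion F]) := by
  have hι : Function.Injective (toPlace v w) := (toPlace v w).injective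
  have h20 : (2 : v.adicCompletion F) ≠ 0 := fun h0 => by
    have h := h2e; rw [h0, mul_zero] at h; exact zero_ne_one h
  -- `s 𝒪 ⊆ 𝒪` from the isometry
  have hsO : ∀ x : 𝒪[v.adicCompletion F], s x ∈ 𝒪[v.adicCompletion F] := fun x => by
    rw [mem_integer_iff_valued_le_one, hsv]; exact (mem_integer_iff_valued_le_one _).1 x.2
  have he : v.asIdeal.ramificationIdx' w.1.asIdeal = 2 := ramificationIdx'_eq_two_of_uniformizer E v σ hσδ hδ hm hd hdm w
  -- ★ [T2-L] (L1) and (L2)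
  obtain ⟨θ, hθ, hθv, hcoord, hint⟩ := exists_sqrt_and_coord_of_ramified E v σ hσδ hδ hm hd hdm w
  obtain ⟨⟨s', hs'ι, hs'θ, hs's', hs'O⟩, ⟨ι', hι'ι, hι'θ, hι'ι', hι'O⟩⟩ :=
    exists_involutions_of_ramified E v σ hσδ hδ hm hd hdm w s hss hsd hsO hθ
  -- valuations in the Eisenstein coordinates
  have hιv : ∀ p : v.adicCompletion F, Valued.v (toPlace v w p) = Valued.v p ^ 2 := valued_toPlace_of_ramificationIdx'_eq_two E v w he
  have hval : ∀ p q : v.adicCompletion F, Valued.v (toPlace v w p + toPlace v w q * θ) = max (Valued.v p ^ 2) (Valued.v q ^ 2 * WithZero.exp (-1 : ℤ)) :=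
    valued_toPlace_add_toPlace_mul_of_ramified E v w he hθv
  have hco : ∀ z : w.1.adicCompletion E, ∃ pq : v.adicCompletion F × v.adicCompletion F, z = toPlace v w pq.1 + toPlace v w pq.2 * θ :=
    fun z => (hcoord z).exists
  have hs'pq : ∀ p q : v.adicCompletion F, s' (toPlace v w p + toPlace v w q * θ) = toPlace v w (s p) + toPlace v w (s q) * θ := fun p q => by
    rw [map_add, map_mul, hs'ι, hs'ι, hs'θ]
  have hι'pq : ∀ p q : v.adicCompletion F, ι' (toPlace v w p + toPlace v w q * θ) = toPlace v w p + toPlace v w (-q) * θ := fun p q => by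
    rw [map_add, map_mul, hι'ι, hι'ι, hι'θ, map_neg]; ring
  -- isometries and the commutation
  have hs'v : ∀ z, Valued.v (s' z) = Valued.v z := fun z => by
    obtain ⟨pq, rfl⟩ := hco z
    rw [hs'pq, hval, hval, hsv, hsv]
  have hι'v : ∀ z, Valued.v (ι' z) = Valued.v z := fun z => by
    obtain ⟨pq, rfl⟩ := hco z
    rw [hι'pq, hval, hval, Valuation.map_neg]
  have hcomm : ∀ z, s' (ι' z) = ι' (s' z) := fun z => by
    obtain ⟨pq, rfl⟩ := hco z
    rw [hι'pq, hs'pq, hs'pq, hι'pq, map_neg]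
  -- `ι′`-fixed elements are `ι₁ p`
  have hθ0 : θ ≠ 0 := fun h0 => by rw [h0, map_zero] at hθv; exact WithZero.coe_ne_zero hθv.symm
  have hfix : ∀ x : w.1.adicCompletion E, ι' x = x → ∃ p : v.adicCompletion F, x = toPlace v w p := by
    intro x hx
    obtain ⟨pq, rfl⟩ := hco x
    rw [hι'pq] at hx
    have huniq := (hcoord (toPlace v w pq.1 + toPlace v w pq.2 * θ)).unique (y₁ := (pq.1, -pq.2)) (y₂ := (pq.1, pq.2)) hx.symm rfl
    have hq : pq.2 = 0 := by
      have h1 : -pq.2 = pq.2 := congrArg Prod.snd huniq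
      have h2' : (2 : v.adicCompletion F) * pq.2 = 0 := by linear_combination -h1
      exact (mul_eq_zero.1 h2').resolve_left h20
    exact ⟨pq.1, by rw [hq, map_zero, zero_mul, add_zero]⟩
  -- the scalars `e = ι₁ e₂`, `T`, `Y`, `ι₁ D`
  have h2e' : toPlace v w e₂ * 2 = 1 := by rw [← map_ofNat (toPlace v w) 2, ← map_mul, h2e, map_one]
  have hD' : 4 * toPlace v w D = toPlace v w t * toPlace v w t - toPlace v w y * toPlace v w y * toPlace v w d := by
    rw [← map_ofNat (toPlace v w) 4, ← map_mul, hD, map_sub, map_mul, map_mul, map_mul]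
  have hse₂ : s e₂ = e₂ := by
    have h1 : s e₂ * 2 = 1 := by
      have := congrArg s h2e
      rwa [map_mul, map_ofNat, map_one] at this
    have h3 : s e₂ * 2 = e₂ * 2 := by rw [h1, h2e]
    exact mul_right_cancel₀ h20 h3
  -- `|t| ≤ 1` and `|D| = 1` (no `|2| = 1`: `|2| ≤ 1` always, `D·sD = 1` with `s` isometric)
  have h2le : Valued.v (2 : v.adicCompletion F) ≤ 1 := by
    rw [show (2 : v.adicCompletion F) = 1 + 1 by norm_num]
    exact (Valuation.map_add _ _ _).trans (by rw [Valuation.map_one, max_self])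
  have hvt : Valued.v t ≤ 1 := by
    have h := Valuation.map_add Valued.v (t - 2) (2 : v.adicCompletion F)
    rw [sub_add_cancel] at h
    exact h.trans (max_le ht2.le h2le)
  have hvD : Valued.v D = 1 := by
    have h := congrArg Valued.v hσD
    rw [map_mul, hsv, map_one] at h
    rcases eq_or_ne (Valued.v D) 0 with h0 | h0
    · rw [h0, zero_mul] at h; exact absurd h zero_ne_one
    · rw [← WithZero.exp_log h0, ← WithZero.exp_add, ← WithZero.exp_zero, WithZero.exp_inj] at h
      rw [← WithZero.exp_log h0, ← WithZero.exp_zero]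
      congr 1; omega
  have hy0 : y ≠ 0 := fun h0 => by rw [h0, map_zero] at hN; exact WithZero.coe_ne_zero hN.symm
  -- the eigenvalue `λ₁ = (T + Yθ)e` and its conjugate
  have hlam_coord : (toPlace v w t + toPlace v w y * θ) * toPlace v w e₂ = toPlace v w (e₂ * t) + toPlace v w (e₂ * y) * θ := by
    rw [map_mul, map_mul]; ring
  have hι'lam : ι' ((toPlace v w t + toPlace v w y * θ) * toPlace v w e₂) = (toPlace v w t - toPlace v w y * θ) * toPlace v w e₂ := by
    rw [map_mul, map_add, map_mul, hι'ι, hι'ι, hι'ι, hι'θ]; ring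
  have hs'lam : s' ((toPlace v w t + toPlace v w y * θ) * toPlace v w e₂) =
      toPlace v w (s D) * ((toPlace v w t - toPlace v w y * θ) * toPlace v w e₂) := by
    rw [map_mul, map_add, map_mul, hs'ι, hs'ι, hs'ι, hs'θ, hσt, hσy, hse₂, map_mul, map_neg, map_mul]; ring
  have hdiff : (toPlace v w t + toPlace v w y * θ) * toPlace v w e₂ - (toPlace v w t - toPlace v w y * θ) * toPlace v w e₂ = toPlace v w y * θ := by
    linear_combination (toPlace v w y * θ) * h2e'
  -- the elementary symmetric functions of `λ₁ = (T + Yθ)e` and `λ₂ = (T − Yθ)e`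
  have hsum : (toPlace v w t + toPlace v w y * θ) * toPlace v w e₂ + (toPlace v w t - toPlace v w y * θ) * toPlace v w e₂ = toPlace v w t := by
    linear_combination (toPlace v w t) * h2e'
  have hprd : (toPlace v w t + toPlace v w y * θ) * toPlace v w e₂ * ((toPlace v w t - toPlace v w y * θ) * toPlace v w e₂) = toPlace v w D := by
    linear_combination (-(toPlace v w e₂ ^ 2 * toPlace v w y ^ 2)) * hθ + (-(toPlace v w e₂ ^ 2)) * hD' +
      (toPlace v w D * (2 * toPlace v w e₂ + 1)) * h2e'
  have hquad : ((toPlace v w t + toPlace v w y * θ) * toPlace v w e₂) ^ 2 - toPlace v w t * ((toPlace v w t + toPlace v w y * θ) * toPlace v w e₂) +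
      toPlace v w D = 0 := by
    linear_combination ((toPlace v w t + toPlace v w y * θ) * toPlace v w e₂) * hsum - hprd
  have hprod : (toPlace v w u - (toPlace v w t + toPlace v w y * θ) * toPlace v w e₂) * (toPlace v w u - (toPlace v w t - toPlace v w y * θ) * toPlace v w e₂) =
      toPlace v w (u * u - t * u + D) := by
    rw [map_add, map_sub, map_mul, map_mul]
    linear_combination (-(toPlace v w u)) * hsum + hprd
  have hnorm1 : (toPlace v w t + toPlace v w y * θ) * toPlace v w e₂ * s' ((toPlace v w t + toPlace v w y * θ) * toPlace v w e₂) = 1 := by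
    have hσD' : toPlace v w D * toPlace v w (s D) = 1 := by rw [← map_mul, hσD, map_one]
    rw [hs'lam]
    linear_combination (toPlace v w (s D)) * hprd + hσD'
  -- `λ₁ ∈ 𝒪`: ROOT ARGUMENT (★ `v_le_one_of_root_quadratic`), no `|e₂| = 1`; and its integral Eisenstein coordinates `(e₂t, e₂y)` by `hint`
  have hlamO : (toPlace v w t + toPlace v w y * θ) * toPlace v w e₂ ∈ 𝒪[w.1.adicCompletion E] := by
    refine (mem_integer_iff_valued_le_one _).2 (v_le_one_of_root_quadratic (T := toPlace v w t) (Δ := toPlace v w D) (by linear_combination hquad) ?_ ?_)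
    · rw [hιv]; exact pow_le_one₀ zero_le hvt
    · rw [hιv, hvD, one_pow]
  have hpq : e₂ * t ∈ 𝒪[v.adicCompletion F] ∧ e₂ * y ∈ 𝒪[v.adicCompletion F] := by
    have h := hlamO
    rw [hlam_coord, hint] at h
    exact h
  refine ⟨θ, s', ι', ⟨hθ, hθv, hcoord, hint⟩, ⟨hs'ι, hs'θ, hs's', hs'O, hs'v⟩, ⟨hι'ι, hι'θ, hι'ι', hι'O, hι'v, hcomm⟩,
    ⟨hquad, hlamO, ?_, hnorm1, hι'lam, ?_, ?_, ?_⟩, ⟨?_, ?_, ?_⟩, hpq⟩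
  · -- `|λ₁ − 1| < 1`: ROOT ARGUMENT on the shifted polynomial `X² − (t−2)X + (1 − t + D)` (★ `v_lt_one_of_root_quadratic`), no `|e₂| = 1`
    refine v_lt_one_of_root_quadratic (T := toPlace v w (t - 2)) (Δ := toPlace v w (1 - t + D)) ?_ ?_ ?_
    · rw [map_sub, map_ofNat, map_add, map_sub, map_one]
      linear_combination hquad
    · rw [hιv]; exact pow_lt_one₀ zero_le ht2 two_ne_zero
    · rw [hιv]; exact pow_lt_one₀ zero_le hχ1 two_ne_zero
  · -- `ι′ λ₁ ≠ λ₁`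
    rw [hι'lam]
    intro h
    have h0 : toPlace v w y * θ = 0 := by rw [← hdiff, h, sub_self]
    rcases mul_eq_zero.1 h0 with h1 | h1
    · exact hy0 ((map_eq_zero_iff _ hι).1 h1)
    · exact hθ0 h1
  · -- `|ι₁ u − λ₁| = exp(−n)`
    have hsq : Valued.v (toPlace v w u - (toPlace v w t + toPlace v w y * θ) * toPlace v w e₂) ^ 2 = WithZero.exp (-(n : ℤ)) ^ 2 := by
      have hconj : ι' (toPlace v w u - (toPlace v w t + toPlace v w y * θ) * toPlace v w e₂) = toPlace v w u - (toPlace v w t - toPlace v w y * θ) * toPlace v w e₂ := by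
        rw [map_sub, hι'ι, hι'lam]
      rw [sq, ← WithZero.exp_nsmul]
      nth_rw 2 [← hι'v]
      rw [hconj, ← map_mul, hprod, hιv, hn, ← WithZero.exp_nsmul]
    have h0 : Valued.v (toPlace v w u - (toPlace v w t + toPlace v w y * θ) * toPlace v w e₂) ≠ 0 := by
      intro h0; rw [h0, zero_pow two_ne_zero, eq_comm] at hsq; exact (pow_ne_zero 2 WithZero.exp_ne_zero) hsq
    have hx := WithZero.exp_log h0
    rw [← hx, ← WithZero.exp_nsmul, ← WithZero.exp_nsmul, WithZero.exp_inj, nsmul_eq_mul, nsmul_eq_mul] at hsq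
    rw [← hx]
    congr 1
    push_cast at hsq
    omega
  · -- `|λ₁ − ι′λ₁| = exp(−(2N+1))`
    rw [hι'lam, hdiff, map_mul, hιv, hN, hθv, ← WithZero.exp_nsmul, ← WithZero.exp_add, nsmul_eq_mul]
    congr 1; push_cast; ring
  · -- (rE)
    intro x hx0 hx
    obtain ⟨p, rfl⟩ := hfix x hx
    have hp0 : Valued.v p ≠ 0 := fun h0 => hx0 (by rw [(Valuation.zero_iff _).1 h0, map_zero])
    rw [hιv, sq, WithZero.log_mul hp0 hp0]
    exact ⟨_, rfl⟩
  · -- (nK): `s̃`-fixed elements of even order are norms from `K` (★ (L3))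
    intro c hc0 hsc ⟨k, hk⟩
    have hvc0 : Valued.v c ≠ 0 := (Valuation.ne_zero_iff _).2 hc0
    -- `u₀ := c · θ^{2k}` is an `s̃`-fixed unit
    have hu₀v : Valued.v (c * θ ^ (k + k)) = 1 := by
      rw [map_mul, map_zpow₀, hθv, ← WithZero.exp_zsmul, ← WithZero.exp_log hvc0, hk, ← WithZero.exp_add, ← WithZero.exp_zero]
      congr 1; simp only [smul_eq_mul]; ring
    have hu₀O : c * θ ^ (k + k) ∈ 𝒪[w.1.adicCompletion E] := (mem_integer_iff_valued_le_one _).2 hu₀v.le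
    have hu₀ne : c * θ ^ (k + k) ≠ 0 := mul_ne_zero hc0 (zpow_ne_zero _ hθ0)
    have hu₀u : IsUnit (⟨c * θ ^ (k + k), hu₀O⟩ : 𝒪[w.1.adicCompletion E]) := by
      have hinvO : (c * θ ^ (k + k))⁻¹ ∈ 𝒪[w.1.adicCompletion E] := (mem_integer_iff_valued_le_one _).2 (by rw [map_inv₀, hu₀v, inv_one])
      exact IsUnit.of_mul_eq_one ⟨_, hinvO⟩ (Subtype.ext (mul_inv_cancel₀ hu₀ne))
    have hsu₀ : s' ((⟨c * θ ^ (k + k), hu₀O⟩ : 𝒪[w.1.adicCompletion E]) : w.1.adicCompletion E) = c * θ ^ (k + k) := by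
      change s' (c * θ ^ (k + k)) = _
      rw [map_mul, map_zpow₀, hsc, hs'θ]
    obtain ⟨t₀, ht₀⟩ := exists_mul_map_eq_of_ramified E v w s hmove s' hs'ι hs's' hs'O _ hu₀u hsu₀
    have ht₀' : (t₀ : w.1.adicCompletion E) * s' t₀ = c * θ ^ (k + k) := ht₀
    have ht₀0 : (t₀ : w.1.adicCompletion E) ≠ 0 := by
      intro h0
      rw [h0, zero_mul] at ht₀'
      exact hu₀ne ht₀'.symm
    have hs't₀0 : s' (t₀ : w.1.adicCompletion E) ≠ 0 := (map_ne_zero s').2 ht₀0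
    refine ⟨θ ^ k * (t₀ : w.1.adicCompletion E)⁻¹, ?_⟩
    rw [map_mul, map_inv₀, map_zpow₀, hs'θ]
    field_simp
    rw [ht₀', zpow_add₀ hθ0]
    ring
  · -- (nE): doubly fixed elements with `4 ∣ log` are norms of `ι′`-fixed elements (`hnormF`)
    intro c hc0 hsc hιc h4
    obtain ⟨p, rfl⟩ := hfix c hιc
    have hp0 : p ≠ 0 := fun h0 => hc0 (by rw [h0, map_zero])
    have hvp0 : Valued.v p ≠ 0 := (Valuation.ne_zero_iff _).2 hp0
    have hsp : s p = p := hι (by rw [← hs'ι, hsc])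
    have heven : Even (WithZero.log (Valued.v p)) := by
      rw [hιv, sq, WithZero.log_mul hvp0 hvp0] at h4
      obtain ⟨r, hr⟩ := h4
      exact ⟨r, by omega⟩
    obtain ⟨a₀, ha₀⟩ := hnormF p hp0 hsp heven
    exact ⟨toPlace v w a₀, hι'ι a₀, by rw [hs'ι, ← map_mul, ← map_mul, ha₀, map_one]⟩

end Literature.NumberTheory.Rogawski1990

end
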